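import Literature.Computability.Complexity.IrreducibilityLLLGcd
import Literature.Computability.Complexity.IrreducibilityLLLResultant
import HarnessLib

/-!
# Hensel lifting on coefficient lists (LLL 1982, §3, step (3.2))

Support file for the discharge of the named fact
`Literature.Computability.Complexity.lll_monicIrreducible_mem_P` (irreducibility of monic integer
polynomials is decidable in `P`; Lenstra–Lenstra–Lovász 1982, §3). Step (3.2) of LLL82: from the
factorisation `f ≡ h·g (mod p)` with `h` monic and `gcd(h mod p, g mod p) = 1`, "using Hensel's lemma
[Knuth 4.6.2, exercise 22]" one computes `h mod p^k` with `(h mod p^k) ∣ (f mod p^k)`. This file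
writes the linear Hensel lift as a total functional program on coefficient lists (all arithmetic
reduced, a fold over a unary budget of `k - 1` steps) and proves its specification:

* `MonicList U d` (`|U| = d + 1`, last entry `1`: the list of a monic integer polynomial of degree
  `d`) and its reading in `ℤ[X]` / `(ℤ/M)[X]`; `PCong M a b` (`a ≡ b (mod M ℤ[X])`, as equality
  of reductions) with its arithmetic;
* `henselStep`, `henselLift p k f u₁` — with `w₁ = f̄/ū`, Bezout `s ū + t w̄ = 1` from `pxgcd`,
  and per step `e = (f - U W)/m`, `τ = t ē mod ū`, `σ = (ē - τ w̄)/ū`, `U ← U + m τ`,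
  `W ← W + m σ` (mod `m p`);
* **`henselLift_spec`** (`p` prime, `f` monic integral, `ū = u₁ mod p` a monic factor of `f mod p`
  coprime to its cofactor, `k ≥ 1`): the output `U` satisfies `MonicList U d`, is reduced modulo
  `p^k`, `U ≡ u₁ (mod p)`, and `ofCoeffs U ∣ ofCoeffs f` modulo `p^k`
  (`ModDvd (p^k) (ofCoeffs U) (ofCoeffs f)`, the hypothesis of the lattice criterion).

## References

* D. E. Knuth, *The Art of Computer Programming*, Vol. 2, 3rd ed., 1998, §4.6.2, exercise 22
  (Hensel's lemma, the linear lift). [KnuthTAOCP2]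
* A. K. Lenstra, H. W. Lenstra Jr., L. Lovász, Math. Ann. 261 (1982), §3, (3.2) and proof of (3.6).
  [LenstraLenstraLovasz1982]
* M. R. Bremner, *Lattice Basis Reduction*, CRC Press 2011, §15.5, Thm. 15.21 (Hensel lifting of a
  coprime factorisation, algorithm `Hensel`). [Bremner2011]
-/

noncomputable section

namespace Literature.Computability.Complexity

open Polynomial SumcheckMA

namespace LLLFactoring

/-! ### Monic lists and congruences of integer polynomials -/

/-- `U` is the coefficient list of a monic integer polynomial of degree `d`: `|U| = d + 1` and the
last entry is `1`. [folklore] -/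
def MonicList (U : List ℤ) (d : ℕ) : Prop := U.length = d + 1 ∧ U.getLast? = some 1

/-- The polynomial of a monic list is monic of degree `d`. [folklore] -/
theorem MonicList.monic_ofCoeffs {U : List ℤ} {d : ℕ} (h : MonicList U d) :
    (ofCoeffs U).Monic ∧ (ofCoeffs U).natDegree = d := by
  obtain ⟨hlen, hlast⟩ := h
  have hU0 : U ≠ [] := by rintro rfl; simp at hlen
  have hd : (ofCoeffs U).coeff d = 1 := by
    rw [coeff_ofCoeffs, List.getD_eq_getElem?_getD, show d = U.length - 1 by omega, ← List.getLast?_eq_getElem?, hlast]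
    rfl
  have hle : (ofCoeffs U).natDegree ≤ d := by
    rw [natDegree_le_iff_coeff_eq_zero]; intro N hN
    rw [coeff_ofCoeffs, List.getD_eq_default _ _ (by omega)]
  have hmon : (ofCoeffs U).Monic := monic_of_natDegree_le_of_coeff_eq_one d hle hd
  refine ⟨hmon, le_antisymm hle (le_natDegree_of_ne_zero (by rw [hd]; exact one_ne_zero))⟩

/-- The reduction of a monic list modulo `M ≥ 2` is monic of degree `d`. [folklore] -/
theorem MonicList.monic_toZMod {U : List ℤ} {d M : ℕ} (h : MonicList U d) (hM : 1 < M) :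
    (toZMod M U).Monic ∧ (toZMod M U).natDegree = d := by
  haveI : Fact (1 < M) := ⟨hM⟩
  obtain ⟨hmon, hdeg⟩ := h.monic_ofCoeffs
  exact ⟨hmon.map _, by rw [toZMod, hmon.natDegree_map, hdeg]⟩

/-- A normal list modulo `M ≥ 2` whose polynomial is monic of degree `d` is a monic list. [folklore] -/
theorem monicList_of_normal {U : List ℤ} {d M : ℕ} (hM : 1 < M) (hn : Normal M U) (hm : (toZMod M U).Monic)
    (hd : (toZMod M U).natDegree = d) : MonicList U d := by
  haveI : Fact (1 < M) := ⟨hM⟩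
  have hU0 : U ≠ [] := fun h0 => by
    have := hm.ne_zero; rw [h0, toZMod_nil] at this; exact this rfl
  obtain ⟨hdeg, hlead⟩ := hn.natDegree_toZMod hU0
  have hpos := List.length_pos_of_ne_nil hU0
  refine ⟨by omega, ?_⟩
  rw [List.getLast?_eq_some_getLast hU0, Option.some.injEq]
  have hc := hn.1 _ (List.getLast_mem hU0)
  have h1 : ((U.getLast hU0 : ℤ) : ZMod M) = ((1 : ℤ) : ZMod M) := by rw [← hlead, hm.leadingCoeff, Int.cast_one]
  exact eq_of_cast_eq_of_reduced hc ⟨zero_le_one, by exact_mod_cast hM⟩ h1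

/-- **Congruence of integer polynomials modulo `M`**: equal reductions in `(ℤ/M)[X]`. [folklore] -/
def PCong (M : ℕ) (a b : ℤ[X]) : Prop := a.map (Int.castRingHom (ZMod M)) = b.map (Int.castRingHom (ZMod M))

/-- A reduction vanishes iff `M` divides the polynomial coefficientwise. [folklore] -/
theorem map_eq_zero_iff_C_dvd {M : ℕ} (x : ℤ[X]) : x.map (Int.castRingHom (ZMod M)) = 0 ↔ C (M : ℤ) ∣ x := by
  rw [C_dvd_iff_dvd_coeff, Polynomial.ext_iff]
  refine forall_congr' fun j => ?_
  rw [coeff_map, coeff_zero, Int.coe_castRingHom, ZMod.intCast_zmod_eq_zero_iff_dvd]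

/-- `PCong M a b ↔ C M ∣ a - b`. [folklore] -/
theorem pcong_iff_dvd {M : ℕ} {a b : ℤ[X]} : PCong M a b ↔ C (M : ℤ) ∣ a - b := by
  rw [← map_eq_zero_iff_C_dvd, Polynomial.map_sub, sub_eq_zero]; rfl

variable {M : ℕ}

/-- `PCong` is reflexive. [folklore] -/
theorem PCong.refl (a : ℤ[X]) : PCong M a a := rfl
/-- `PCong` is symmetric. [folklore] -/
theorem PCong.symm {a b : ℤ[X]} (h : PCong M a b) : PCong M b a := Eq.symm h
/-- `PCong` is transitive. [folklore] -/
theorem PCong.trans {a b c : ℤ[X]} (h₁ : PCong M a b) (h₂ : PCong M b c) : PCong M a c := Eq.trans h₁ h₂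
/-- `PCong` is compatible with addition. [folklore] -/
theorem PCong.add {a b c d : ℤ[X]} (h₁ : PCong M a b) (h₂ : PCong M c d) : PCong M (a + c) (b + d) := by
  unfold PCong at *; rw [Polynomial.map_add, Polynomial.map_add, h₁, h₂]
/-- `PCong` is compatible with subtraction. [folklore] -/
theorem PCong.sub {a b c d : ℤ[X]} (h₁ : PCong M a b) (h₂ : PCong M c d) : PCong M (a - c) (b - d) := by
  unfold PCong at *; rw [Polynomial.map_sub, Polynomial.map_sub, h₁, h₂]
/-- `PCong` is compatible with multiplication. [folklore] -/
theorem PCong.mul {a b c d : ℤ[X]} (h₁ : PCong M a b) (h₂ : PCong M c d) : PCong M (a * c) (b * d) := by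
  unfold PCong at *; rw [Polynomial.map_mul, Polynomial.map_mul, h₁, h₂]

/-- Congruences descend to divisors of the modulus. [folklore] -/
theorem PCong.of_dvd {M M' : ℕ} (hM : M' ∣ M) {a b : ℤ[X]} (h : PCong M a b) : PCong M' a b := by
  rw [pcong_iff_dvd] at h ⊢
  obtain ⟨c, rfl⟩ := hM
  exact dvd_trans ⟨C (c : ℤ), by rw [← C_mul]; norm_cast⟩ h

/-- Scaling a congruence: `a ≡ b (M)` gives `m a ≡ m b (m M)`. [folklore] -/
theorem PCong.mul_scale {M m : ℕ} {a b : ℤ[X]} (h : PCong M a b) : PCong (m * M) (C (m : ℤ) * a) (C (m : ℤ) * b) := by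
  rw [pcong_iff_dvd] at h ⊢
  rw [← mul_sub, Nat.cast_mul, C_mul]
  exact mul_dvd_mul_left _ h

/-- `m² x ≡ 0 (m M)` when `M ∣ m`. [folklore] -/
theorem pcong_sq_zero {M m : ℕ} (hM : M ∣ m) (x : ℤ[X]) : PCong (m * M) (C (m : ℤ) * C (m : ℤ) * x) 0 := by
  rw [pcong_iff_dvd, sub_zero, Nat.cast_mul, C_mul]
  obtain ⟨c, rfl⟩ := hM
  exact ⟨C (c : ℤ) * x, by push_cast; rw [C_mul]; ring⟩

/-- `toZMod` equalities are congruences of the `ofCoeffs`. [folklore] -/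
theorem pcong_ofCoeffs_iff {a b : List ℤ} : PCong M (ofCoeffs a) (ofCoeffs b) ↔ toZMod M a = toZMod M b := Iff.rfl

/-- A congruent factorisation is divisibility modulo `M`. [folklore] -/
theorem modDvd_of_pcong {f U W : ℤ[X]} (h : PCong M f (U * W)) : ModDvd M U f := by
  obtain ⟨c, hc⟩ := pcong_iff_dvd.1 h
  exact modDvd_iff.2 ⟨W, c, by rw [← hc]; ring⟩

/-! ### Exact division of a vanishing list by the modulus -/

/-- Coefficientwise exact division by `m`. [cite: KnuthTAOCP2, §4.6.2, exercise 22 (the step (f - gh)/p^e)] -/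
def pdivConst (m : ℕ) (e : List ℤ) : List ℤ := e.map fun c => c / (m : ℤ)

/-- If `ē = 0` modulo `m` then `m · (e / m) = e` as polynomials. [folklore] -/
theorem ofCoeffs_pdivConst {m : ℕ} {e : List ℤ} (he : toZMod m e = 0) :
    C (m : ℤ) * ofCoeffs (pdivConst m e) = ofCoeffs e := by
  ext j
  rw [coeff_C_mul, coeff_ofCoeffs, coeff_ofCoeffs, pdivConst, List.getD_eq_getElem?_getD, List.getElem?_map,
    List.getD_eq_getElem?_getD]
  have hj : ((e.getD j 0 : ℤ) : ZMod m) = 0 := by rw [← coeff_toZMod, he, coeff_zero]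
  rw [ZMod.intCast_zmod_eq_zero_iff_dvd, List.getD_eq_getElem?_getD] at hj
  cases h : e[j]? with
  | none => simp
  | some c =>
    rw [h] at hj
    simp only [Option.map_some, Option.getD_some] at hj ⊢
    exact Int.mul_ediv_cancel' hj

/-- Length of `pdivConst`. [folklore] -/
@[simp] theorem length_pdivConst (m : ℕ) (e : List ℤ) : (pdivConst m e).length = e.length := List.length_map _

/-! ### The lifting step and loop -/

/-- One linear Hensel step from modulus `m` to `m p` on the state `(m, U, W)`: `e = (f - U W)/m`,
`ē = e mod p`, `τ = t ē mod ū`, `σ = (ē - τ w̄)/ū` (mod `p`), `U ← U + m τ`, `W ← W + m σ`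
(reduced modulo `m p`). [cite: KnuthTAOCP2, §4.6.2, exercise 22] [cite: Bremner2011, §15.5 (algorithm Hensel)] -/
def henselStep (p : ℕ) (f u₁ w₁ t : List ℤ) (st : ℕ × List ℤ × List ℤ) : ℕ × List ℤ × List ℤ :=
  let m := st.1
  let eb := pnorm p (pdivConst m (psub f (pmul st.2.1 st.2.2)))
  let τ := pmodM p (pmul t eb) u₁
  let σ := pnorm p (pdivmod p (psub eb (pmul τ w₁)) u₁).1
  (m * p, pnorm (m * p) (padd st.2.1 (pscale (m : ℤ) τ)), pnorm (m * p) (padd st.2.2 (pscale (m : ℤ) σ)))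

/-- The cofactor `w₁ = f̄ / ū` modulo `p`, in normal form. [cite: LenstraLenstraLovasz1982, (3.2)] -/
def henselCofactor (p : ℕ) (f u₁ : List ℤ) : List ℤ := pnorm p (pdivmod p f u₁).1

/-- The run of `j` lifting steps from `(p, u₁, w₁)`. [cite: KnuthTAOCP2, §4.6.2, exercise 22] -/
def henselRun (p : ℕ) (f u₁ : List ℤ) (j : ℕ) : ℕ × List ℤ × List ℤ :=
  (List.replicate j ()).foldl
    (fun st _ => henselStep p f u₁ (henselCofactor p f u₁) (pxgcd p u₁ (henselCofactor p f u₁)).2.2 st)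
    (p, u₁, henselCofactor p f u₁)

/-- **Hensel lifting**: `u₁ mod p ↦ U mod p^k` with `U ∣ f (mod p^k)`, by `k - 1` linear steps.
[cite: LenstraLenstraLovasz1982, (3.2)] [cite: KnuthTAOCP2, §4.6.2, exercise 22] -/
def henselLift (p k : ℕ) (f u₁ : List ℤ) : List ℤ := (henselRun p f u₁ (k - 1)).2.1

section Spec

variable {p : ℕ} [hp : Fact p.Prime]

/-- The loop invariant at modulus `m = p^j`: `U` monic of degree `d`, `U`, `W` normal modulo `m`,
`f ≡ U W (mod m)`, `U ≡ u₁`, `W ≡ w₁ (mod p)`. [cite: KnuthTAOCP2, §4.6.2, exercise 22] -/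
def HInv (p : ℕ) (f u₁ w₁ : List ℤ) (d : ℕ) (j : ℕ) (st : ℕ × List ℤ × List ℤ) : Prop :=
  st.1 = p ^ j ∧ MonicList st.2.1 d ∧ Normal st.1 st.2.1 ∧ Normal st.1 st.2.2 ∧
    PCong st.1 (ofCoeffs f) (ofCoeffs st.2.1 * ofCoeffs st.2.2) ∧
    PCong p (ofCoeffs st.2.1) (ofCoeffs u₁) ∧ PCong p (ofCoeffs st.2.2) (ofCoeffs w₁)

omit hp in
/-- **The Bezout step of the linear lift** (in `K[X]`, `K` any commutative ring): if `s u + t w = 1`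
with `u` monic and `τ = (t e) mod u`, then `u ∣ e - τ w`, and `σ u + τ w = e` for
`σ = (e - τ w) / u`. [cite: KnuthTAOCP2, §4.6.2, exercise 22] -/
theorem bezout_lift_step {K : Type*} [CommRing K] {u w s t : K[X]} (hu : u.Monic) (hbez : s * u + t * w = 1)
    (e : K[X]) : u ∣ e - (t * e %ₘ u) * w ∧ ((e - (t * e %ₘ u) * w) /ₘ u) * u + (t * e %ₘ u) * w = e := by
  have hte := modByMonic_add_div (t * e) u
  have hdvd : u ∣ e - (t * e %ₘ u) * w := by
    refine ⟨e * s + (t * e /ₘ u) * w, ?_⟩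
    have h1 : e = e * (s * u + t * w) := by rw [hbez, mul_one]
    linear_combination h1 - w * hte
  refine ⟨hdvd, ?_⟩
  have h2 := modByMonic_add_div (e - (t * e %ₘ u) * w) u
  rw [(modByMonic_eq_zero_iff_dvd hu).2 hdvd, zero_add] at h2
  linear_combination h2

omit hp in
/-- **The congruence algebra of the linear lift** (in `ℤ[X]`): from `f - U W = m e'`,
`U ≡ u₁`, `W ≡ w₁ (mod p)`, `σ u₁ + τ w₁ ≡ e' (mod p)` and `p ∣ m` it follows that
`(U + m τ)(W + m σ) ≡ f (mod m p)`. [cite: KnuthTAOCP2, §4.6.2, exercise 22] -/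
theorem pcong_lift_product {m : ℕ} (hpm : p ∣ m) {f U W u₁ w₁ σ τ e' : ℤ[X]}
    (hee' : C (m : ℤ) * e' = f - U * W) (hUu : PCong p U u₁) (hWw : PCong p W w₁)
    (hστ : PCong p (σ * u₁ + τ * w₁) e') :
    PCong (m * p) ((U + C (m : ℤ) * τ) * (W + C (m : ℤ) * σ)) f := by
  have hmid : PCong p (τ * W + U * σ) (σ * u₁ + τ * w₁) := by
    have := ((PCong.refl τ).mul hWw).add (hUu.mul (PCong.refl σ))
    have hring : τ * w₁ + u₁ * σ = σ * u₁ + τ * w₁ := by ring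
    rw [hring] at this
    exact this
  have hmid' := (hmid.trans hστ).mul_scale (m := m)
  rw [hee'] at hmid'
  have hsq := pcong_sq_zero hpm (τ * σ)
  have hsum := ((PCong.refl (U * W)).add hmid').add hsq
  have hl : U * W + C (m : ℤ) * (τ * W + U * σ) + C (m : ℤ) * C (m : ℤ) * (τ * σ) =
      (U + C (m : ℤ) * τ) * (W + C (m : ℤ) * σ) := by ring
  have hr : U * W + (f - U * W) + 0 = f := by ring
  rw [hl, hr] at hsum
  exact hsum

omit hp in
/-- `x + m y ≡ x (mod p)` when `p ∣ m`. [folklore] -/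
theorem pcong_add_mul_of_dvd {m : ℕ} (hpm : p ∣ m) (x y : ℤ[X]) : PCong p (x + C (m : ℤ) * y) x := by
  rw [pcong_iff_dvd, add_sub_cancel_left]
  obtain ⟨c, hc⟩ := hpm
  exact ⟨C (c : ℤ) * y, by rw [hc]; push_cast; rw [C_mul]; ring⟩

/-- **One lifting step preserves the invariant** (`j ≥ 1`; Bezout data `s ū + t w̄ = 1` modulo `p`
with `ū` monic of degree `d = |u₁| - 1`). [cite: KnuthTAOCP2, §4.6.2, exercise 22] [cite: Bremner2011, Thm. 15.21] -/
theorem henselStep_spec {f u₁ w₁ s t : List ℤ} {d j : ℕ} (hj : 1 ≤ j) (hu₁ : Normal p u₁)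
    (hum : (toZMod p u₁).Monic) (hud : (toZMod p u₁).natDegree = d) (hulen : u₁.length = d + 1)
    (hbez : toZMod p s * toZMod p u₁ + toZMod p t * toZMod p w₁ = 1)
    {st : ℕ × List ℤ × List ℤ} (hst : HInv p f u₁ w₁ d j st) :
    HInv p f u₁ w₁ d (j + 1) (henselStep p f u₁ w₁ t st) := by
  have hp0 := hp.out.pos
  have hp1 := hp.out.one_lt
  obtain ⟨m, U, W⟩ := st
  obtain ⟨hm, hmon, hUn, hWn, hfUW, hUu, hWw⟩ := hst
  dsimp only at hm hmon hUn hWn hfUW hUu hWw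
  subst hm
  have hu0 : u₁ ≠ [] := by rintro rfl; simp at hulen
  have hud' : (toZMod p u₁).natDegree = u₁.length - 1 := by rw [hud, hulen]; rfl
  have hpm : p ∣ p ^ j := dvd_pow_self p (by omega)
  have hmp0 : 0 < p ^ j * p := Nat.mul_pos (Nat.pow_pos hp0) hp0
  have hmp1 : 1 < p ^ j * p := by have := Nat.one_le_pow j p hp0; nlinarith
  -- the error term `e = (f - U W) / p^j`
  have heZ : toZMod (p ^ j) (psub f (pmul U W)) = 0 := by
    rw [toZMod_psub, toZMod_pmul]
    have h : toZMod (p ^ j) f = toZMod (p ^ j) U * toZMod (p ^ j) W := by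
      have := hfUW; unfold PCong at this; rwa [Polynomial.map_mul] at this
    exact sub_eq_zero.2 h
  have hee' : C ((p ^ j : ℕ) : ℤ) * ofCoeffs (pdivConst (p ^ j) (psub f (pmul U W))) = ofCoeffs f - ofCoeffs U * ofCoeffs W := by
    rw [ofCoeffs_pdivConst heZ, psub, ofCoeffs_padd, ofCoeffs_pscale, ofCoeffs_pmul, map_neg, map_one]; ring
  -- names for the step data
  set eb := pnorm p (pdivConst (p ^ j) (psub f (pmul U W))) with heb
  set τ := pmodM p (pmul t eb) u₁ with hτ
  set σ := pnorm p (pdivmod p (psub eb (pmul τ w₁)) u₁).1 with hσ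
  -- modulo `p`: `σ ū + τ w̄ = ē`
  have hτZ : toZMod p τ = (toZMod p t * toZMod p eb) %ₘ toZMod p u₁ := by
    rw [hτ, toZMod_pmodM hp0 hu0 hum hud', toZMod_pmul]
  obtain ⟨hdvdB, hσB⟩ := bezout_lift_step (w := toZMod p w₁) hum hbez (toZMod p eb)
  have hσZ : toZMod p σ * toZMod p u₁ + toZMod p τ * toZMod p w₁ = toZMod p eb := by
    have hq := (toZMod_pdivmod hp0 (a := psub eb (pmul τ w₁)) hu0 hum hud').1
    rw [toZMod_psub, toZMod_pmul, hτZ] at hq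
    rw [hσ, toZMod_pnorm, hq, hτZ]
    exact hσB
  have hστ : PCong p (ofCoeffs σ * ofCoeffs u₁ + ofCoeffs τ * ofCoeffs w₁) (ofCoeffs (pdivConst (p ^ j) (psub f (pmul U W)))) := by
    unfold PCong
    rw [Polynomial.map_add, Polynomial.map_mul, Polynomial.map_mul]
    change toZMod p σ * toZMod p u₁ + toZMod p τ * toZMod p w₁ = toZMod p (pdivConst (p ^ j) (psub f (pmul U W)))
    rw [hσZ, heb, toZMod_pnorm]
  -- the new values
  show HInv p f u₁ w₁ d (j + 1)
    (p ^ j * p, pnorm (p ^ j * p) (padd U (pscale ((p ^ j : ℕ) : ℤ) τ)), pnorm (p ^ j * p) (padd W (pscale ((p ^ j : ℕ) : ℤ) σ)))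
  have hU'c : PCong (p ^ j * p) (ofCoeffs (pnorm (p ^ j * p) (padd U (pscale ((p ^ j : ℕ) : ℤ) τ))))
      (ofCoeffs U + C ((p ^ j : ℕ) : ℤ) * ofCoeffs τ) := by
    have h1 : PCong (p ^ j * p) (ofCoeffs (pnorm (p ^ j * p) (padd U (pscale ((p ^ j : ℕ) : ℤ) τ))))
        (ofCoeffs (padd U (pscale ((p ^ j : ℕ) : ℤ) τ))) := pcong_ofCoeffs_iff.2 (toZMod_pnorm _)
    rwa [ofCoeffs_padd, ofCoeffs_pscale] at h1
  have hW'c : PCong (p ^ j * p) (ofCoeffs (pnorm (p ^ j * p) (padd W (pscale ((p ^ j : ℕ) : ℤ) σ))))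
      (ofCoeffs W + C ((p ^ j : ℕ) : ℤ) * ofCoeffs σ) := by
    have h1 : PCong (p ^ j * p) (ofCoeffs (pnorm (p ^ j * p) (padd W (pscale ((p ^ j : ℕ) : ℤ) σ))))
        (ofCoeffs (padd W (pscale ((p ^ j : ℕ) : ℤ) σ))) := pcong_ofCoeffs_iff.2 (toZMod_pnorm _)
    rwa [ofCoeffs_padd, ofCoeffs_pscale] at h1
  refine ⟨by rw [pow_succ], ?_, normal_pnorm hmp0 _, normal_pnorm hmp0 _, ?_, ?_, ?_⟩
  · -- `U + m τ` is monic of degree `d` (`deg τ < d`)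
    haveI : Fact (1 < p ^ j * p) := ⟨hmp1⟩
    obtain ⟨hAm, hAd⟩ := hmon.monic_toZMod hmp1
    have hBdeg : (C ((((p ^ j : ℕ) : ℤ)) : ZMod (p ^ j * p)) * toZMod (p ^ j * p) τ).degree <
        (toZMod (p ^ j * p) U).degree := by
      rw [← smul_eq_C_mul]
      refine (degree_smul_le _ _).trans_lt ((degree_toZMod_lt _).trans_le ?_)
      rw [degree_eq_natDegree hAm.ne_zero, hAd]
      have := length_pmodM_lt hp0 (a := pmul t eb) hu0 hum hud'
      rw [← hτ, hulen] at this
      exact_mod_cast (by omega)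
    refine monicList_of_normal hmp1 (normal_pnorm hmp0 _) ?_ ?_
    · rw [toZMod_pnorm, toZMod_padd, toZMod_pscale]; exact hAm.add_of_left hBdeg
    · rw [toZMod_pnorm, toZMod_padd, toZMod_pscale, natDegree_add_eq_left_of_degree_lt hBdeg, hAd]
  · -- `f ≡ U' W' (mod m p)`
    exact ((hU'c.mul hW'c).trans (pcong_lift_product hpm hee' hUu hWw hστ)).symm
  · -- `U' ≡ u₁ (mod p)`
    exact ((hU'c.of_dvd (dvd_mul_left p _)).trans (pcong_add_mul_of_dvd hpm _ _)).trans hUu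
  · -- `W' ≡ w₁ (mod p)`
    exact ((hW'c.of_dvd (dvd_mul_left p _)).trans (pcong_add_mul_of_dvd hpm _ _)).trans hWw

omit hp in
/-- Unfolding the run. [folklore] -/
theorem henselRun_succ (f u₁ : List ℤ) (j : ℕ) :
    henselRun p f u₁ (j + 1) = henselStep p f u₁ (henselCofactor p f u₁) (pxgcd p u₁ (henselCofactor p f u₁)).2.2 (henselRun p f u₁ j) := by
  rw [henselRun, List.replicate_succ', List.foldl_append, List.foldl_cons, List.foldl_nil, ← henselRun]

omit hp in
/-- The run at time `0`. [folklore] -/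
theorem henselRun_zero (f u₁ : List ℤ) : henselRun p f u₁ 0 = (p, u₁, henselCofactor p f u₁) := rfl

/-- **The lifting run**: after `j` steps the invariant holds at modulus `p^{j+1}`.
[cite: KnuthTAOCP2, §4.6.2, exercise 22] -/
theorem henselRun_spec {f u₁ : List ℤ} {d : ℕ} (hu₁ : Normal p u₁) (hum : (toZMod p u₁).Monic)
    (hud : (toZMod p u₁).natDegree = d) (hdvd : toZMod p u₁ ∣ toZMod p f)
    (hcop : IsCoprime (toZMod p u₁) (toZMod p (henselCofactor p f u₁))) : ∀ j : ℕ,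
    HInv p f u₁ (henselCofactor p f u₁) d (j + 1) (henselRun p f u₁ j)
  | 0 => by
    have hp0 := hp.out.pos
    have hp1 := hp.out.one_lt
    have hmon : MonicList u₁ d := monicList_of_normal hp1 hu₁ hum hud
    have hu0 : u₁ ≠ [] := by rintro rfl; simp [MonicList] at hmon
    have hud' : (toZMod p u₁).natDegree = u₁.length - 1 := by rw [hud, hmon.1]; rfl
    rw [henselRun_zero]
    refine ⟨(pow_one p).symm, hmon, hu₁, normal_pnorm hp0 _, ?_, PCong.refl _, PCong.refl _⟩
    -- `f ≡ u₁ w₁ (mod p)`: the remainder of `f̄` by `ū` vanishes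
    show PCong p (ofCoeffs f) (ofCoeffs u₁ * ofCoeffs (henselCofactor p f u₁))
    unfold PCong
    rw [Polynomial.map_mul]
    change toZMod p f = toZMod p u₁ * toZMod p (henselCofactor p f u₁)
    obtain ⟨hqr, -⟩ := pdivmod_spec hp0 (a := f) hu0 hum hud'
    have hr0 : toZMod p (pdivmod p f u₁).2 = 0 := by
      rw [(toZMod_pdivmod hp0 hu0 hum hud').2, modByMonic_eq_zero_iff_dvd hum]; exact hdvd
    rw [henselCofactor, toZMod_pnorm, mul_comm]
    rw [hr0, add_zero] at hqr
    exact hqr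
  | j + 1 => by
    have hp1 := hp.out.one_lt
    have hmon : MonicList u₁ d := monicList_of_normal hp1 hu₁ hum hud
    rw [henselRun_succ]
    refine henselStep_spec (s := (pxgcd p u₁ (henselCofactor p f u₁)).2.1) (by omega) hu₁ hum hud hmon.1 ?_
      (henselRun_spec hu₁ hum hud hdvd hcop j)
    -- Bezout from the extended gcd: the gcd is `[1]`
    obtain ⟨hbez, -⟩ := pxgcd_spec (p := p) u₁ (henselCofactor p f u₁)
    have h1 : pgcd p u₁ (henselCofactor p f u₁) = [1] := (isCoprime_iff_pgcd_eq_one _ _).1 hcop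
    rw [pgcd] at h1
    rw [h1, toZMod_cons, toZMod_nil, mul_zero, add_zero, Int.cast_one, C_1] at hbez
    exact hbez.symm

/-- **Hensel lifting is correct** (LLL82 (3.2)): for `p` prime, `u₁` a normal list with `ū` monic of
degree `d` dividing `f̄` modulo `p` and coprime to its cofactor, and `k ≥ 1`, the lifted list
`U = henselLift p k f u₁` is the coefficient list of a monic integer polynomial of degree `d`,
reduced modulo `p^k`, congruent to `u₁` modulo `p`, and dividing `f` modulo `p^k`.
[cite: LenstraLenstraLovasz1982, (3.2)] [cite: KnuthTAOCP2, §4.6.2, exercise 22] -/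
theorem henselLift_spec {f u₁ : List ℤ} {d k : ℕ} (hk : 1 ≤ k) (hu₁ : Normal p u₁) (hum : (toZMod p u₁).Monic)
    (hud : (toZMod p u₁).natDegree = d) (hdvd : toZMod p u₁ ∣ toZMod p f)
    (hcop : IsCoprime (toZMod p u₁) (toZMod p (henselCofactor p f u₁))) :
    MonicList (henselLift p k f u₁) d ∧ Normal (p ^ k) (henselLift p k f u₁) ∧
      toZMod p (henselLift p k f u₁) = toZMod p u₁ ∧
      ModDvd (p ^ k) (ofCoeffs (henselLift p k f u₁)) (ofCoeffs f) := by
  obtain ⟨hm, hmon, hUn, -, hfUW, hUu, -⟩ := henselRun_spec hu₁ hum hud hdvd hcop (k - 1)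
  have hk' : k - 1 + 1 = k := by omega
  rw [hk'] at hm
  rw [henselLift, ← hm]
  exact ⟨hmon, hUn, hUu, modDvd_of_pcong hfUW⟩

end Spec

end LLLFactoring

end Literature.Computability.Complexity
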